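import Summits.CriticalPhenomena.SAWScalingLimit.Theorems.SAWTotalPositivityBoundaryTP2Defs
import Summits.CriticalPhenomena.SAWScalingLimit.Theorems.SAWTotalPositivityBoundaryTP2Kernel
import Summits.CriticalPhenomena.SAWScalingLimit.Theorems.SAWTotalPositivityBoundaryTP2Symmetry
import Summits.CriticalPhenomena.SAWScalingLimit.Theorems.EdgeOfPositivity.Negative.EdgeOfPositivityRectDomain
import Literature.Probability.Percolation.PlanarDuality
import HarnessLib

/-!
# Crux `BoundaryTP2` (stmt-CriticalPhenomena-7115), line `Sketch`: stub `stub_strip4_interlaced`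

Tool stub W4-C0 of the line's skeleton (the planar input of the width-4 transfer recursion): in the
box `{0..L} × {0,1,2,3}` (`discreteDomainGraph (rectDomain L 3) 1`) every self-avoiding path `P` from
a left-column site `(0,r)` to a right-column site `(L,s)` meets every self-avoiding path `Q` between
two right-column sites `(L,u)`, `(L,v)` with `u < s < v`.

Proof (extension trick, as in `…BoundaryTP2RectFacingPairs`): in `ℤ²` (`Walk.mapLe`), prolong `P`
by the horizontal step `(L,s) → (L+1,s)` into a left–right crossing of the big box
`[0, L+1] × [-1, 4]`, and prolong `Q` by the runs `(L+1,-1) ↑ (L+1,u) → (L,u)` and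
`(L,v) → (L+1,v) ↑ (L+1,4)` into a bottom–top crossing of the same box. The discrete Jordan lemma
`Literature.Probability.Percolation.exists_mem_support_of_crossing` gives a common vertex; the added
vertices all lie on column `L+1` (off the original box, which contains both supports by
`support_subset_rectSites`), and `(L+1,s)` is not on the prolonged `Q` since there the heights are
`≤ u < s` or `≥ v > s`; so the common vertex is common to `P` and `Q`.
-/

noncomputable section

namespace Summit.CriticalPhenomena.SAWScalingLimit.Theorems.BoundaryTP2

open Literature.Probability.LatticeModels Literature.Probability.RandomPlanarGeometry
open Summit.CriticalPhenomena.SAWScalingLimit.Theorems.EdgeOfPositivity.Negative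
open scoped ENNReal

/-- A vertical lattice segment `{i} × {m..n}` of `ℤ²` (`m ≤ n`) carries a lattice walk from `(i,m)` up
to `(i,n)` all of whose vertices lie on that segment. [folklore] -/
private theorem s4il_exists_zdColWalk (i m n : ℤ) (hmn : m ≤ n) :
    ∃ W : (zdGraph 2).Walk (st i m) (st i n), ∀ z ∈ W.support, z 0 = i ∧ m ≤ z 1 ∧ z 1 ≤ n := by
  -- adapted from `exists_zdColWalk` in `…BoundaryTP2RectFacingPairs`
  induction n, hmn using Int.leInduction with
  | base =>
    refine ⟨SimpleGraph.Walk.nil, fun z hz => ?_⟩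
    rw [SimpleGraph.Walk.support_nil, List.mem_singleton] at hz
    subst hz
    rw [st_zero, st_one]
    exact ⟨rfl, le_rfl, le_rfl⟩
  | succ n hmn ih =>
    obtain ⟨W, hW⟩ := ih
    refine ⟨W.concat (zdGraph_adj_st_succ_right i n), fun z hz => ?_⟩
    rw [SimpleGraph.Walk.support_concat, List.mem_append, List.mem_singleton] at hz
    rcases hz with hz | rfl
    · have := hW z hz
      omega
    · rw [st_zero, st_one]
      omega

/-- **Tool stub `stub_strip4_interlaced`** (W4-C0). Planar input of the width-4 transfer: in the box
`{0..L} × {0..3}` every self-avoiding path from the left column `(0,r)` to `(L,s)` meets every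
self-avoiding path between two right-column sites `(L,u)`, `(L,v)` with `u < s < v`. Extension
trick: prolong the first path by `(L,s) → (L+1,s)` into a left–right crossing of
`[0,L+1] × [-1,4]` and the second by `(L+1,-1) ↑ (L+1,u) → (L,u)`, `(L,v) → (L+1,v) ↑ (L+1,4)` into
a bottom–top crossing; they meet (`exists_mem_support_of_crossing`), and the added vertices (column
`L+1`; the one of the first path at height `s ∉ (-∞,u] ∪ [v,∞)`) avoid the other walk. [folklore] -/
theorem stub_strip4_interlaced (L : ℕ) (r : ℤ) (hr : 0 ≤ r ∧ r ≤ 3) (u s v : ℤ) (hu : 0 ≤ u) (hus : u < s)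
    (hsv : s < v) (hv : v ≤ 3) :
    Interlaced (discreteDomainGraph (rectDomain L 3) 1) (st 0 r) (st L u) (st L s) (st L v) := by
  -- adapted from `interlaced_facingPairs` in `…BoundaryTP2RectFacingPairs`
  intro P Q
  have hle : discreteDomainGraph (rectDomain L 3) 1 ≤ zdGraph 2 :=
    discreteDomainGraph_le_zdGraph (rectDomain L 3) 1
  have hp₁ : st 0 r ∈ rectSites L 3 := by rw [mem_rectSites_iff, st_zero, st_one]; omega
  have hp₂ : st (L : ℤ) u ∈ rectSites L 3 := by rw [mem_rectSites_iff, st_zero, st_one]; omega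
  -- the original supports lie in the box `[0, L] × [0, 3]`
  have hP₀ : ∀ z ∈ P.1.support, (0 : ℤ) ≤ z 0 ∧ z 0 ≤ (L : ℤ) ∧ (0 : ℤ) ≤ z 1 ∧ z 1 ≤ (3 : ℤ) := by
    intro z hz
    have := mem_rectSites_iff.1 (support_subset_rectSites hp₁ P.1 z hz)
    omega
  have hQ₀ : ∀ z ∈ Q.1.support, (0 : ℤ) ≤ z 0 ∧ z 0 ≤ (L : ℤ) ∧ (0 : ℤ) ≤ z 1 ∧ z 1 ≤ (3 : ℤ) := by
    intro z hz
    have := mem_rectSites_iff.1 (support_subset_rectSites hp₂ Q.1 z hz)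
    omega
  -- the three horizontal unit steps out of the box (to / from column `L+1`)
  have e₂ : (zdGraph 2).Adj (st L s) (st (L + 1) s) := zdGraph_adj_st_succ_left L s
  have e₃ : (zdGraph 2).Adj (st (L + 1) u) (st L u) := (zdGraph_adj_st_succ_left L u).symm
  have e₄ : (zdGraph 2).Adj (st L v) (st (L + 1) v) := zdGraph_adj_st_succ_left L v
  -- the two vertical runs on column `L+1` closing `Q` up into a bottom-top crossing
  obtain ⟨C₁, hC₁⟩ := s4il_exists_zdColWalk (L + 1) (-1) u (by omega)
  obtain ⟨C₂, hC₂⟩ := s4il_exists_zdColWalk (L + 1) v 4 (by omega)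
  -- the prolonged `P`: a left-right crossing of the big box `[0, L+1] × [-1, 4]`
  obtain ⟨P', hP'⟩ : ∃ P' : (zdGraph 2).Walk (st 0 r) (st (L + 1) s), ∀ z ∈ P'.support,
      z ∈ P.1.support ∨ (z 0 = L + 1 ∧ z 1 = s) := by
    refine ⟨(P.1.mapLe hle).concat e₂, fun z hz => ?_⟩
    rw [SimpleGraph.Walk.support_concat, List.mem_append, List.mem_singleton,
      SimpleGraph.Walk.support_mapLe_eq_support] at hz
    rcases hz with hz | rfl
    · exact Or.inl hz
    · exact Or.inr ⟨st_zero _ _, st_one _ _⟩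
  -- the prolonged `Q`: a bottom-top crossing of the big box
  obtain ⟨Q', hQ'⟩ : ∃ Q' : (zdGraph 2).Walk (st (L + 1) (-1)) (st (L + 1) 4), ∀ z ∈ Q'.support,
      z ∈ Q.1.support ∨ (z 0 = L + 1 ∧ -1 ≤ z 1 ∧ z 1 ≤ u) ∨
        (z 0 = L + 1 ∧ v ≤ z 1 ∧ z 1 ≤ 4) := by
    refine ⟨C₁.append (SimpleGraph.Walk.cons e₃ (((Q.1.mapLe hle).concat e₄).append C₂)),
      fun z hz => ?_⟩
    rw [SimpleGraph.Walk.mem_support_append_iff, SimpleGraph.Walk.support_cons, List.mem_cons,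
      SimpleGraph.Walk.mem_support_append_iff, SimpleGraph.Walk.support_concat, List.mem_append,
      List.mem_singleton, SimpleGraph.Walk.support_mapLe_eq_support] at hz
    rcases hz with hz | rfl | (hz | rfl) | hz
    · exact Or.inr (Or.inl (hC₁ z hz))
    · refine Or.inr (Or.inl ?_)
      rw [st_zero, st_one]
      omega
    · exact Or.inl hz
    · refine Or.inr (Or.inr ?_)
      rw [st_zero, st_one]
      omega
    · exact Or.inr (Or.inr (hC₂ z hz))
  -- both prolonged walks stay in the big box
  have hP'box : ∀ z ∈ P'.support,
      (0 : ℤ) ≤ z 0 ∧ z 0 ≤ (L : ℤ) + 1 ∧ (-1 : ℤ) ≤ z 1 ∧ z 1 ≤ (4 : ℤ) := by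
    intro z hz
    rcases hP' z hz with hz | hz
    · have := hP₀ z hz
      omega
    · omega
  have hQ'box : ∀ z ∈ Q'.support,
      (0 : ℤ) ≤ z 0 ∧ z 0 ≤ (L : ℤ) + 1 ∧ (-1 : ℤ) ≤ z 1 ∧ z 1 ≤ (4 : ℤ) := by
    intro z hz
    rcases hQ' z hz with hz | hz | hz
    · have := hQ₀ z hz
      omega
    · omega
    · omega
  -- a left-right crossing meets a bottom-top crossing of the big box
  obtain ⟨z, hzP, hzQ⟩ := Literature.Probability.Percolation.exists_mem_support_of_crossing
    P' Q' hP'box hQ'box (st_zero _ _) (st_zero _ _) (st_one _ _) (st_one _ _)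
  -- the common vertex is a vertex of both original paths
  refine ⟨z, ?_⟩
  rcases hP' z hzP with hzP | hzP
  · rcases hQ' z hzQ with hzQ | hzQ | hzQ
    · exact ⟨hzP, hzQ⟩
    · exfalso
      have := hP₀ z hzP
      omega
    · exfalso
      have := hP₀ z hzP
      omega
  · exfalso
    rcases hQ' z hzQ with hzQ | hzQ | hzQ
    · have := hQ₀ z hzQ
      omega
    · omega
    · omega

end Summit.CriticalPhenomena.SAWScalingLimit.Theorems.BoundaryTP2
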